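import Summits.Ventures.PercRepro.RankLevelSetMinorPairNormSkew
import Summits.Ventures.PercRepro.RankLevelSetBiIndepContainNormParallel
import Summits.Ventures.PercRepro.RankLevelSetBiIndepAvoidNormSkew

/-! # RankLevelSetMinorPairNormSkewParallel — THE NORMALIZED HALF RULE (NHR) IS CLOSED UNDER PARALLEL EXTENSION
AND VACUOUS ON MATROIDS WITH A LOOP (night-1 g31; dossier §43.3)

For a parallel pair `{y, z}` and `N = M ／ {y} ＼ {z}`, g30's identities give the contain profiles of `M` from those of
`N`: `X ⊇ {y, z}`: zero; `y ∈ X ∌ z`: `α^X_{r+1}(M) = α^{X∖{y}}_r(N)` (the same normalization, `#E − 2#X =`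
`#E(N) − 2#(X ∖ {y})`); `X ∌ y, z`: `α^X_{r+1}(M) = 2·α^X_r(N)`, the normalizations two apart
(`C(N′, j)·j·(N′ − j) = C(N′ − 2, j − 1)·N′(N′ − 1)`, and `i(N′ − i) ≤ j(N′ − j)` on the pairs `i < j`,
`i + j ≤ N′`). So NHR of `N` gives NHR of `M` (**`biContainNormHalf_of_parallel`**) — the parallel-extension
closure of the NHR class (with `biContainNormHalf_disjointSum`, `biContainNormHalf_truncateTo`,
`biContainNormHalf_of_paving`); a loop empties every profile (**`biContainNormHalf_of_loop`**). Every declaration has a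
docstring; imports: the cell's own modules and Mathlib only. Axioms: standard. -/

namespace PercRepro

open Set Matroid

variable {α : Type} (M : Matroid α) [M.Finite]

/-- **NHR in the level index**: `BiContainNormHalf M ↔ ∀ X ⊆ E, ∀ i < j, i + j ≤ #E − 2#X →`
`α^X_{#X+i}·C(#E − 2#X, j) ≤ α^X_{#X+j}·C(#E − 2#X, i)`. -/
lemma biContainNormHalf_iff :
    BiContainNormHalf M ↔ ∀ X ⊆ M.E, ∀ i j : ℕ, i < j → i + j ≤ M.E.ncard - 2 * X.ncard →
      biContainCount M X (X.ncard + i) * (M.E.ncard - 2 * X.ncard).choose j ≤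
        biContainCount M X (X.ncard + j) * (M.E.ncard - 2 * X.ncard).choose i := by
  constructor
  · intro h X hX i j hij hR
    have hi := biContainCount_eq_minorPairCount M hX (k := X.ncard + i) (by omega)
    have hj := biContainCount_eq_minorPairCount M hX (k := X.ncard + j) (by omega)
    rw [Nat.add_sub_cancel_left] at hi hj
    rw [hi, hj]
    exact h X hX i j hij hR
  · intro h X hX i j hij hR
    have hi := biContainCount_eq_minorPairCount M hX (k := X.ncard + i) (by omega)
    have hj := biContainCount_eq_minorPairCount M hX (k := X.ncard + j) (by omega)
    rw [Nat.add_sub_cancel_left] at hi hj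
    rw [← hi, ← hj]
    exact h X hX i j hij hR

/-- **A matroid with a loop satisfies NHR** (every contain profile is empty). -/
theorem biContainNormHalf_of_loop {ℓ : α} (hℓE : ℓ ∈ M.E) (hℓ : ¬ M.Indep {ℓ}) : BiContainNormHalf M := by
  intro X hX i j _ _
  have h0 := biContainCount_eq_zero_of_loop M hℓE hℓ X
  have hi := biContainCount_eq_minorPairCount M hX (k := X.ncard + i) (by omega)
  rw [Nat.add_sub_cancel_left] at hi
  rw [← hi, h0, Nat.zero_mul]
  exact Nat.zero_le _

/-- **NHR IS CLOSED UNDER PARALLEL EXTENSION**: for a parallel pair `{y, z}`,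
`BiContainNormHalf (M ／ {y} ＼ {z}) → BiContainNormHalf M`. -/
theorem biContainNormHalf_of_parallel {y z : α} (h : ParallelPair M y z)
    (hN : BiContainNormHalf ((M.contract {y}).delete {z})) : BiContainNormHalf M := by
  haveI : ((M.contract {y}).delete {z}).Finite := by infer_instance
  rw [biContainNormHalf_iff] at hN ⊢
  intro X hX i j hij hR
  have hn := ncard_ground_contract_delete M h
  have hn2 := two_le_ncard_of_parallel M h
  have hXfin : X.Finite := M.ground_finite.subset hX
  by_cases hyX : y ∈ X <;> by_cases hzX : z ∈ X
  · rw [biContainCount_parallel_both M h hyX hzX, Nat.zero_mul]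
    exact Nat.zero_le _
  · -- `y ∈ X`, `z ∉ X`: the profile of `N` at `X ∖ {y}`, same normalization
    have hX' : X \ {y} ⊆ ((M.contract {y}).delete {z}).E :=
      sdiff_subset_ground_contract_delete (M := M) (y := y) (z := z) hX hzX
    have hc : (X \ {y}).ncard = X.ncard - 1 := Set.ncard_sdiff_singleton_of_mem hyX
    have hc1 : 0 < X.ncard := (Set.ncard_pos hXfin).mpr ⟨y, hyX⟩
    have e1 : X.ncard + i = (X.ncard - 1 + i) + 1 := by omega
    have e2 : X.ncard + j = (X.ncard - 1 + j) + 1 := by omega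
    rw [e1, e2, biContainCount_parallel_mem_left M h hyX, biContainCount_parallel_mem_left M h hyX]
    have := hN (X \ {y}) hX' i j hij (by rw [hn, hc]; omega)
    rw [hn, hc] at this
    have e3 : M.E.ncard - 2 - 2 * (X.ncard - 1) = M.E.ncard - 2 * X.ncard := by omega
    rw [e3] at this
    exact this
  · -- `z ∈ X`, `y ∉ X`: symmetric
    have hX' : X \ {z} ⊆ ((M.contract {y}).delete {z}).E := by
      have := sdiff_subset_ground_contract_delete (M := M) (y := z) (z := y) hX hyX
      rwa [ground_contract_delete, Set.pair_comm, ← ground_contract_delete] at this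
    have hc : (X \ {z}).ncard = X.ncard - 1 := Set.ncard_sdiff_singleton_of_mem hzX
    have hc1 : 0 < X.ncard := (Set.ncard_pos hXfin).mpr ⟨z, hzX⟩
    have e1 : X.ncard + i = (X.ncard - 1 + i) + 1 := by omega
    have e2 : X.ncard + j = (X.ncard - 1 + j) + 1 := by omega
    rw [e1, e2, biContainCount_parallel_mem_right M h hzX, biContainCount_parallel_mem_right M h hzX]
    have := hN (X \ {z}) hX' i j hij (by rw [hn, hc]; omega)
    rw [hn, hc] at this
    have e3 : M.E.ncard - 2 - 2 * (X.ncard - 1) = M.E.ncard - 2 * X.ncard := by omega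
    rw [e3] at this
    exact this
  · -- neither: `α^X_{r+1}(M) = 2 α^X_r(N)`, normalizations two apart
    have hX' : X ⊆ ((M.contract {y}).delete {z}).E := by
      rw [ground_contract_delete]
      intro x hx
      refine ⟨hX hx, ?_⟩
      simp only [Set.mem_insert_iff, Set.mem_singleton_iff, not_or]
      exact ⟨fun hxy => hyX (hxy ▸ hx), fun hxz => hzX (hxz ▸ hx)⟩
    rcases Nat.eq_zero_or_pos (X.ncard + i) with h0 | hpos
    · rw [h0, biContainCount_parallel_zero M h X, Nat.zero_mul]
      exact Nat.zero_le _
    rcases Nat.eq_zero_or_pos i with hi0 | hi1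
    · subst hi0
      have e1 : X.ncard + 0 = (X.ncard - 1) + 1 := by omega
      rw [e1, biContainCount_parallel_notMem M h hyX hzX, biContainCount_eq_zero_of_lt_ncard _ (by omega)]
      simp
    set N' := M.E.ncard - 2 * X.ncard with hN'
    have e1 : X.ncard + i = (X.ncard + (i - 1)) + 1 := by omega
    have e2 : X.ncard + j = (X.ncard + (j - 1)) + 1 := by omega
    rw [e1, e2, biContainCount_parallel_notMem M h hyX hzX, biContainCount_parallel_notMem M h hyX hzX]
    have hNj := hN X hX' (i - 1) (j - 1) (by omega) (by rw [hn]; omega)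
    rw [hn] at hNj
    have e3 : M.E.ncard - 2 - 2 * X.ncard = N' - 2 := by omega
    rw [e3] at hNj
    obtain ⟨m, hm⟩ : ∃ m, N' = m + 1 + 1 := ⟨N' - 2, by omega⟩
    obtain ⟨ti, hti⟩ : ∃ t, i = t + 1 := ⟨i - 1, by omega⟩
    obtain ⟨tj, htj⟩ : ∃ t, j = t + 1 := ⟨j - 1, by omega⟩
    have hi' := choose_mul_eq_choose_sub_two m ti
    have hj' := choose_mul_eq_choose_sub_two m tj
    rw [hm, hti, htj] at hNj ⊢
    simp only [Nat.add_sub_cancel] at hNj ⊢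
    -- the factor `t (N' − t)` is nondecreasing on the required pairs `i + j ≤ N'`
    have hfac : (ti + 1) * (m + 1 - ti) ≤ (tj + 1) * (m + 1 - tj) := by
      have := SkewConv.mul_sub_le_mul_sub (N := m) (i := ti + 1) (j := tj + 1) (by omega) (by omega)
      rwa [show m + 2 - (ti + 1) = m + 1 - ti by omega, show m + 2 - (tj + 1) = m + 1 - tj by omega] at this
    have hpos' : 0 < (ti + 1) * (m + 1 - ti) := Nat.mul_pos (Nat.succ_pos _) (by omega)
    set A := biContainCount ((M.contract {y}).delete {z}) X (X.ncard + ti) with hA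
    set B := biContainCount ((M.contract {y}).delete {z}) X (X.ncard + tj) with hB
    refine Nat.le_of_mul_le_mul_right (c := (ti + 1) * (m + 1 - ti)) ?_ hpos'
    calc 2 * A * (m + 1 + 1).choose (tj + 1) * ((ti + 1) * (m + 1 - ti))
        ≤ 2 * A * (m + 1 + 1).choose (tj + 1) * ((tj + 1) * (m + 1 - tj)) := Nat.mul_le_mul_left _ hfac
      _ = 2 * A * (m.choose tj * (m + 1 + 1) * (m + 1)) := by rw [← hj']; ring
      _ = 2 * (A * m.choose tj) * ((m + 1 + 1) * (m + 1)) := by ring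
      _ ≤ 2 * (B * m.choose ti) * ((m + 1 + 1) * (m + 1)) := by
          apply Nat.mul_le_mul_right
          apply Nat.mul_le_mul_left
          exact hNj
      _ = 2 * B * (m.choose ti * (m + 1 + 1) * (m + 1)) := by ring
      _ = 2 * B * (m + 1 + 1).choose (ti + 1) * ((ti + 1) * (m + 1 - ti)) := by rw [← hi']; ring

end PercRepro
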